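import Summits.AnomalousDissipation.AnomalousDissipation.Theorems.SawtoothPulseCascadeK1LocalisedCascadeSlotExpansionTwoBranch

/-!
# K1loc, line `Spectral` / SeqCone — helper: SPLITTING AND RECOMBINING THE TWO STRIP FAMILIES (S-C bookkeeping)

Helper file of the prover lane on the crux `K1LocalisedCascade` (stmt-AnomalousDissipation-19491), route
`SawtoothPulseCascade` (memo v6 §4, S-C).  The tracked-family steps (`…FamilyStep`) run ONE strip family across a
half-slot: output `O_σ ≤ I_σ + e`.  To chain half-slots the two families must be SPLIT at the start of a slot
(`Σ_σ ‖μ(D)(X̃^σ w)‖² ≤ ‖μ(D)((X̃⁺+X̃⁻)w)‖² + 2c₀`) and RECOMBINED at its end (`‖m(D)((X⁺+X⁻)w)‖² ≤ Σ_σ ‖m(D)(X^σ w)‖² + 2c₁`,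
the tree's `tsum_symbol_sq_add_le_of_bounds`), the cross terms `c₀, c₁` being small by the disjointness of the families
(`…SpectralCommutator.norm_tsum_symbol_sq_cross_le`, `…SlotExpansionTwoBranch.norm_tsum_symbol_sq_cross_le_of_expansion`).
This file supplies the lower two-piece inequality (`tsum_symbol_sq_add_ge_of_bound`) and the resulting arithmetic of one
chained step (`recombine_families`: `O ≤ I + √2·e + √(2c₀) + √(2c₁)`).  No definitions; no statement about the stub.
[cite: Grafakos2014, Prop. 3.2.7 (3) (Parseval)] [problem: turb]
-/

-- `Summit.<Summit>.<Problem>`: single-conjunct summit, the duplicate namespace segment is deliberate.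
set_option linter.dupNamespace false

noncomputable section

namespace Summit.AnomalousDissipation.AnomalousDissipation.Theorems.SawtoothPulseCascade.K1Slot

open MeasureTheory Set Filter Topology UnitAddTorus Complex
open scoped ComplexConjugate
open Literature.Analysis Literature.Analysis.FunctionSpaces Literature.Analysis.FluidPDE
open Literature.Analysis.FunctionSpaces.Torus
open Summit.AnomalousDissipation.AnomalousDissipation.Theorems.SawtoothPulseCascade.SpectralLeakage

variable {d : Type*} [Fintype d]

/-! ## The lower two-piece inequality -/

/-- **Splitting a weighted energy into two pieces**: for continuous `P, Q`, a bounded real symbol `m` and a bound `c`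
on the cross term `|Σ m² 𝓕P conj 𝓕Q|`:
`Σ m²|𝓕P|² + Σ m²|𝓕Q|² ≤ Σ m²|𝓕(P+Q)|² + 2c` (the polarisation identity, other direction than
`tsum_symbol_sq_add_le_of_bounds`). [cite: Grafakos2014, Prop. 3.2.7 (3)] -/
theorem tsum_symbol_sq_add_ge_of_bound {P Q : UnitAddTorus d → ℂ} (hP : Continuous P) (hQ : Continuous Q)
    {m : (d → ℤ) → ℝ} {M : ℝ} (hmM : ∀ k, |m k| ≤ M) {c : ℝ}
    (hc : ‖∑' k, ((m k ^ 2 : ℝ) : ℂ) * mFourierCoeff P k * conj (mFourierCoeff Q k)‖ ≤ c) :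
    ∑' k, m k ^ 2 * ‖mFourierCoeff P k‖ ^ 2 + ∑' k, m k ^ 2 * ‖mFourierCoeff Q k‖ ^ 2 ≤
      ∑' k, m k ^ 2 * ‖mFourierCoeff (fun x => P x + Q x) k‖ ^ 2 + 2 * c := by
  have hm2 : ∀ k, m k ^ 2 ≤ M ^ 2 := fun k => by
    rw [← sq_abs]; exact pow_le_pow_left₀ (abs_nonneg _) (hmM k) 2
  set a : (d → ℤ) → ℂ := mFourierCoeff P with ha_def
  set b : (d → ℤ) → ℂ := mFourierCoeff Q with hb_def
  have hPa := hasSum_sq_mFourierCoeff_of_continuous hP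
  have hPb := hasSum_sq_mFourierCoeff_of_continuous hQ
  have ha : Summable fun k => m k ^ 2 * ‖a k‖ ^ 2 :=
    (hPa.summable.mul_left (M ^ 2)).of_nonneg_of_le (fun k => by positivity)
      fun k => mul_le_mul_of_nonneg_right (hm2 k) (sq_nonneg _)
  have hb : Summable fun k => m k ^ 2 * ‖b k‖ ^ 2 :=
    (hPb.summable.mul_left (M ^ 2)).of_nonneg_of_le (fun k => by positivity)
      fun k => mul_le_mul_of_nonneg_right (hm2 k) (sq_nonneg _)
  have hu : Summable fun k => ‖((m k ^ 2 : ℝ) : ℂ) * a k‖ ^ 2 :=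
    (hPa.summable.mul_left ((M ^ 2) ^ 2)).of_nonneg_of_le (fun k => by positivity) fun k => by
      rw [norm_mul, mul_pow, Complex.norm_real, Real.norm_eq_abs, abs_of_nonneg (sq_nonneg _)]
      exact mul_le_mul_of_nonneg_right (pow_le_pow_left₀ (sq_nonneg _) (hm2 k) 2) (sq_nonneg _)
  obtain ⟨hab, _⟩ := norm_tsum_mul_conj_le hu hPb.summable
  obtain ⟨_, heq⟩ := tsum_symbol_sq_norm_add ha hb hab
  have hadd : ∀ k, mFourierCoeff (fun x => P x + Q x) k = a k + b k := fun k =>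
    mFourierCoeff_add hP.integrable_unitAddTorus hQ.integrable_unitAddTorus k
  simp_rw [hadd]
  rw [heq]
  have h3 : -c ≤ (∑' k, ((m k ^ 2 : ℝ) : ℂ) * a k * conj (b k)).re := by
    have h := (Complex.abs_re_le_norm (∑' k, ((m k ^ 2 : ℝ) : ℂ) * a k * conj (b k))).trans hc
    rw [abs_le] at h; exact h.1
  linarith

/-- **`√`-form of the split**: each piece's energy is at most the total plus the cross bound, so
`√Σ m²|𝓕P|² ≤ √(Σ m²|𝓕(P+Q)|² + 2c)` and likewise for `Q`; in the symmetric form used by the bookkeeping,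
`√(Σ m²|𝓕P|² + Σ m²|𝓕Q|²) ≤ √Σ m²|𝓕(P+Q)|² + √(2c)` (`c ≥ 0`). [cite: Grafakos2014, Prop. 3.2.7 (3)] -/
theorem sqrt_tsum_symbol_sq_add_le_sqrt_add {P Q : UnitAddTorus d → ℂ} (hP : Continuous P) (hQ : Continuous Q)
    {m : (d → ℤ) → ℝ} {M : ℝ} (hmM : ∀ k, |m k| ≤ M) {c : ℝ} (hc0 : 0 ≤ c)
    (hc : ‖∑' k, ((m k ^ 2 : ℝ) : ℂ) * mFourierCoeff P k * conj (mFourierCoeff Q k)‖ ≤ c) :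
    Real.sqrt (∑' k, m k ^ 2 * ‖mFourierCoeff P k‖ ^ 2 + ∑' k, m k ^ 2 * ‖mFourierCoeff Q k‖ ^ 2) ≤
      Real.sqrt (∑' k, m k ^ 2 * ‖mFourierCoeff (fun x => P x + Q x) k‖ ^ 2) + Real.sqrt (2 * c) := by
  have sqrt_add_le : ∀ {x y : ℝ}, 0 ≤ x → 0 ≤ y → Real.sqrt (x + y) ≤ Real.sqrt x + Real.sqrt y := by
    intro x y hx hy
    have h : x + y ≤ (Real.sqrt x + Real.sqrt y) ^ 2 := by
      nlinarith [Real.sq_sqrt hx, Real.sq_sqrt hy, Real.sqrt_nonneg x, Real.sqrt_nonneg y]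
    calc Real.sqrt (x + y) ≤ Real.sqrt ((Real.sqrt x + Real.sqrt y) ^ 2) := Real.sqrt_le_sqrt h
      _ = _ := Real.sqrt_sq (add_nonneg (Real.sqrt_nonneg _) (Real.sqrt_nonneg _))
  have h := tsum_symbol_sq_add_ge_of_bound hP hQ hmM hc
  have h0 : 0 ≤ ∑' k, m k ^ 2 * ‖mFourierCoeff (fun x => P x + Q x) k‖ ^ 2 := tsum_nonneg fun k => by positivity
  calc Real.sqrt (∑' k, m k ^ 2 * ‖mFourierCoeff P k‖ ^ 2 + ∑' k, m k ^ 2 * ‖mFourierCoeff Q k‖ ^ 2)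
      ≤ Real.sqrt (∑' k, m k ^ 2 * ‖mFourierCoeff (fun x => P x + Q x) k‖ ^ 2 + 2 * c) := Real.sqrt_le_sqrt h
    _ ≤ _ := sqrt_add_le h0 (by positivity)

/-! ## The arithmetic of one chained step -/

omit [Fintype d] in
/-- **Recombining the two families across one half-slot.**  Suppose the per-family steps give `O_σ ≤ I_σ + e`
(`σ = ±`, all quantities `≥ 0`), the families split at the start, `I₊² + I₋² ≤ I² + 2c₀`, and recombine at the end,
`O² ≤ O₊² + O₋² + 2c₁` (`c₀, c₁ ≥ 0`).  Then `O ≤ I + √2·e + √(2c₀) + √(2c₁)` — the tracked total energy loses, per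
half-slot, `√2` times the per-family error plus the two cross-term roots. [folklore] -/
theorem recombine_families {O Op Om I Ip Im e c₀ c₁ : ℝ} (hO : 0 ≤ O) (hOp : 0 ≤ Op) (hOm : 0 ≤ Om) (hI : 0 ≤ I)
    (hIp : 0 ≤ Ip) (hIm : 0 ≤ Im) (he : 0 ≤ e) (hc₀ : 0 ≤ c₀) (hc₁ : 0 ≤ c₁)
    (hp : Op ≤ Ip + e) (hm : Om ≤ Im + e) (hsplit : Ip ^ 2 + Im ^ 2 ≤ I ^ 2 + 2 * c₀)
    (hrec : O ^ 2 ≤ Op ^ 2 + Om ^ 2 + 2 * c₁) :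
    O ≤ I + Real.sqrt 2 * e + Real.sqrt (2 * c₀) + Real.sqrt (2 * c₁) := by
  have sqrt_add_le : ∀ {x y : ℝ}, 0 ≤ x → 0 ≤ y → Real.sqrt (x + y) ≤ Real.sqrt x + Real.sqrt y := by
    intro x y hx hy
    have h : x + y ≤ (Real.sqrt x + Real.sqrt y) ^ 2 := by
      nlinarith [Real.sq_sqrt hx, Real.sq_sqrt hy, Real.sqrt_nonneg x, Real.sqrt_nonneg y]
    calc Real.sqrt (x + y) ≤ Real.sqrt ((Real.sqrt x + Real.sqrt y) ^ 2) := Real.sqrt_le_sqrt h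
      _ = _ := Real.sqrt_sq (add_nonneg (Real.sqrt_nonneg _) (Real.sqrt_nonneg _))
  -- `Op² + Om² ≤ (√(Ip²+Im²) + √2 e)²`
  have hs2 : Real.sqrt 2 ^ 2 = 2 := Real.sq_sqrt (by norm_num)
  have hs20 : 0 ≤ Real.sqrt 2 := Real.sqrt_nonneg _
  set S := Real.sqrt (Ip ^ 2 + Im ^ 2) with hS
  have hS0 : 0 ≤ S := Real.sqrt_nonneg _
  have hS2 : S ^ 2 = Ip ^ 2 + Im ^ 2 := Real.sq_sqrt (by positivity)
  have hsum : Ip + Im ≤ Real.sqrt 2 * S := by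
    have hsq : (Ip + Im) ^ 2 ≤ (Real.sqrt 2 * S) ^ 2 := by
      rw [mul_pow, hs2, hS2]; nlinarith [sq_nonneg (Ip - Im)]
    exact (pow_le_pow_iff_left₀ (by positivity) (by positivity) two_ne_zero).mp hsq
  have h1 : Op ^ 2 + Om ^ 2 ≤ (S + Real.sqrt 2 * e) ^ 2 := by
    have hp2 : Op ^ 2 ≤ (Ip + e) ^ 2 := pow_le_pow_left₀ hOp hp 2
    have hm2 : Om ^ 2 ≤ (Im + e) ^ 2 := pow_le_pow_left₀ hOm hm 2
    have hexp : (S + Real.sqrt 2 * e) ^ 2 = S ^ 2 + 2 * (Real.sqrt 2 * S) * e + 2 * e ^ 2 := by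
      have : (Real.sqrt 2 * e) ^ 2 = 2 * e ^ 2 := by rw [mul_pow, hs2]
      nlinarith [this]
    rw [hexp, hS2]
    nlinarith [mul_le_mul_of_nonneg_right hsum he]
  -- `S ≤ I + √(2c₀)`
  have h2 : S ≤ I + Real.sqrt (2 * c₀) := by
    calc S ≤ Real.sqrt (I ^ 2 + 2 * c₀) := by rw [hS]; exact Real.sqrt_le_sqrt hsplit
      _ ≤ Real.sqrt (I ^ 2) + Real.sqrt (2 * c₀) := sqrt_add_le (sq_nonneg _) (by positivity)
      _ = I + Real.sqrt (2 * c₀) := by rw [Real.sqrt_sq hI]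
  -- `O ≤ √(Op²+Om²) + √(2c₁) ≤ S + √2 e + √(2c₁)`
  have h3 : O ≤ (S + Real.sqrt 2 * e) + Real.sqrt (2 * c₁) := by
    have hT0 : 0 ≤ S + Real.sqrt 2 * e := by positivity
    calc O = Real.sqrt (O ^ 2) := (Real.sqrt_sq hO).symm
      _ ≤ Real.sqrt ((S + Real.sqrt 2 * e) ^ 2 + 2 * c₁) := Real.sqrt_le_sqrt (hrec.trans (by linarith))
      _ ≤ Real.sqrt ((S + Real.sqrt 2 * e) ^ 2) + Real.sqrt (2 * c₁) :=
          sqrt_add_le (sq_nonneg _) (by positivity)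
      _ = (S + Real.sqrt 2 * e) + Real.sqrt (2 * c₁) := by rw [Real.sqrt_sq hT0]
  linarith

end Summit.AnomalousDissipation.AnomalousDissipation.Theorems.SawtoothPulseCascade.K1Slot
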